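import Literature.Topology.FourManifolds.BasinExtension
import Literature.Topology.FourManifolds.ConeRadialExtension
import Literature.Topology.FourManifolds.SPC4HandlesProofs
import HarnessLib

/-!
# Extension over a compact `3`-manifold with boundary of boundary diffeomorphisms which are the
# identity near the traces of the co-cores (endgame of the Morse line for the Torelli half of
# Griffiths' handlebody theorem)

Topic `Literature/Topology/FourManifolds`; last file of the series `BasinSetting.lean`, …,
`BasinExtension.lean`.  Everything here is **proved**; no named facts.

* `BasinSetting.diffeoExtends_of_forall_eq` — in a basin setting on a compact `3`-manifold with
  boundary, every self-diffeomorphism of `∂W` which is the identity off a closed subset of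
  `∂W ∩ basin(p₀)` extends to a self-diffeomorphism of `W` (`BoundaryData.DiffeoExtends` for the
  boundary datum `BoundaryManifold.boundaryData 2 W`): the extension of `BasinExtension.lean`
  with the cone diffeomorphism `Θ` of `ConeRadialExtension.lean` (Smale: every diffeomorphism of
  `S²` is diffeotopic to the identity or to a reflection; Cerf's radial extension);
* `Cobordism.IsMorseFunction.diffeoExtends_of_eqOn_nhds_traces` — **the endgame theorem, raw
  form**: for `W` compact of dimension `3`, `g` Morse on `(W; ∅, ∂W)` with a smooth gradient-like
  field `ξ` and a unique critical point `p₀` of index `0` (e.g. a genus-`g` handlebody with its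
  Morse data), a self-diffeomorphism `χ` of `∂W` which is the identity on an open set containing
  every boundary point not on a trajectory coming from `p₀` (for a handlebody: a neighbourhood
  of the co-core circles) extends over `W`.  Corollaries: Dehn twists along simple closed curves
  of `∂W` missing the co-core circles extend; every diffeomorphism supported in the planar
  surface `∂W ∖ (co-cores)` extends.

This is the last step of the Morse/wave line for the Torelli criterion (T) of Griffiths'
theorem (`HandlebodyKernelExtensionTorelli.lean`): once a based boundary diffeomorphism acting
trivially on `π₁` has been normalised — by changes of the gradient-like field (Milnor's
Lemma 4.7) and compositions with extendable diffeomorphisms — to the identity near a co-core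
system, it extends by this theorem.  No cutting along discs, no corners, no Schoenflies theorem.

## References

* J. Milnor, *Lectures on the h-cobordism theorem*, notes by L. Siebenmann and J. Sondow,
  Princeton Mathematical Notes (1965): Def. 3.1, proof of Thm. 3.4 (PDF pp. 11–13), Def. 3.9
  (PDF p. 16), Thm. 4.1 (PDF p. 22), proof of Thm. 5.4, Assertion 4 (PDF p. 29).
  [MilnorHCobordism1965]
* J. Milnor, *Morse theory* (1963), Thm. 3.1 and proof of Thm. 4.1 (p. 25). [Milnor1963]
* H. B. Griffiths, *Automorphisms of a 3-dimensional handlebody*, Abh. Math. Sem. Univ. Hamburg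
  26 (1964), §§3–6. [GriffithsHB1964Handlebody]
-/

open scoped Manifold ContDiff Topology
open Set Function Filter Metric

noncomputable section

namespace Literature.Topology.FourManifolds

open Cobordism FourManifolds.Flow

universe u

variable {n : ℕ} {W : Type u} [TopologicalSpace W] [T2Space W] [SecondCountableTopology W]
  [CompactSpace W] [ChartedSpace (EuclideanHalfSpace (n + 1)) W] [IsManifold (𝓡∂ (n + 1)) ∞ W]

/-! ### The endgame theorem in dimension `3` -/

section Three

attribute [local instance] fact_finrank_euclideanSpace_succ

variable {W : Type u} [TopologicalSpace W] [T2Space W] [SecondCountableTopology W]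
  [CompactSpace W] [ChartedSpace (EuclideanHalfSpace (2 + 1)) W] [IsManifold (𝓡∂ (2 + 1)) ∞ W]
  {g : W → ℝ} {ξ : Π x : W, TangentSpace (𝓡∂ (2 + 1)) x}

/-- **Extension of boundary diffeomorphisms supported in the basin (dimension `3`).**  Let
`B` be a basin setting on a compact `3`-manifold with boundary `W` (`g` Morse on `(W; ∅, ∂W)`,
`ξ` gradient-like, `p₀` the unique critical point of index `0`).  Every self-diffeomorphism `χ`
of `∂W` which is the identity off a closed set `K ⊆ ∂W` of points of the basin of `p₀` — i.e.
which is the identity near the traces of the ascending sets of the other critical points (for a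
`1`-handlebody: near the co-core circles) — extends to a self-diffeomorphism of `W`
(`BoundaryData.DiffeoExtends`).  The extension is `pull ∘ Ψ₁ ∘ push`, where `Ψ₁` is the level
conjugation of `χ` along the trajectories of `ξ` (identity on the trajectories whose boundary
point is fixed, in particular near the other critical trajectories), corrected inside a small
ball about `p₀` by Cerf's radial extension of a diffeotopy of the sphere of directions (Smale:
every diffeomorphism of `S²` is diffeotopic to the identity or to a reflection).
[cite: GriffithsHB1964Handlebody, main theorem and §§3–6] [cite: CerfDiffeoSphere1968, Ch. I §1, Lemme 2; Appendice §5, Théorème 4] -/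
theorem BasinSetting.diffeoExtends_of_forall_eq (B : BasinSetting g ξ)
    (χ : (𝓡∂ (2 + 1)).boundary W ≃ₘ⟮𝓡 2, 𝓡 2⟯ (𝓡∂ (2 + 1)).boundary W)
    (K : Set ((𝓡∂ (2 + 1)).boundary W)) (hK : IsClosed K) (hKb : ∀ y ∈ K, (y : W) ∈ B.basin)
    (hχK : ∀ y, y ∉ K → χ y = y) :
    (BoundaryManifold.boundaryData 2 W).DiffeoExtends χ := by
  rcases isEmpty_or_nonempty ((𝓡∂ (2 + 1)).boundary W) with hE | hne
  · refine ⟨Diffeomorph.refl (𝓡∂ (2 + 1)) W ∞, funext fun y => ?_⟩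
    exact (hE.false y).elim
  haveI : Nonempty (BoundaryManifold.boundaryData 2 W).carrier := hne
  haveI : CompactSpace ((𝓡∂ (2 + 1)).boundary W) := compactSpace_boundary 2 W
  have hKc : IsCompact K := hK.isCompact
  -- the inverse, and the properties of the pair
  set χ' : (𝓡∂ (2 + 1)).boundary W → (𝓡∂ (2 + 1)).boundary W := ⇑χ.symm with hχ'
  have h1 : LeftInverse χ' χ := χ.symm_apply_apply
  have h2 : LeftInverse χ χ' := χ.apply_symm_apply
  have hχK' : ∀ y, y ∉ K → χ' y = y := fun y hy => by
    conv_lhs => rw [← hχK y hy]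
    exact h1 y
  have hmapK : ∀ y, y ∈ K → χ y ∈ K := fun y hy => by
    by_contra h
    have h3 : χ' (χ y) = χ y := hχK' _ h
    rw [h1 y] at h3
    rw [h3] at hy
    exact h hy
  have hmapK' : ∀ y, y ∈ K → χ' y ∈ K := fun y hy => by
    by_contra h
    have h3 : χ (χ' y) = χ' y := hχK _ h
    rw [h2 y] at h3
    rw [h3] at hy
    exact h hy
  have htr : ∀ (ψ : (𝓡∂ (2 + 1)).boundary W → (𝓡∂ (2 + 1)).boundary W), (∀ y, y ∉ K → ψ y = y) →
      (∀ y, y ∈ K → ψ y ∈ K) → ∀ y, ψ y ∈ B.traces ↔ y ∈ B.traces := by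
    intro ψ hψ hψK y
    by_cases hy : y ∈ K
    · have a : y ∉ B.traces := fun h => h (hKb y hy)
      have b : ψ y ∉ B.traces := fun h => h (hKb _ (hψK y hy))
      exact ⟨fun h => (b h).elim, fun h => (a h).elim⟩
    · rw [hψ y hy]
  have hχ : ∀ y, χ y ∈ B.traces ↔ y ∈ B.traces := htr χ hχK hmapK
  have hχ'' : ∀ y, χ' y ∈ B.traces ↔ y ∈ B.traces := htr χ' hχK' hmapK'
  -- the diffeomorphism of the sphere of directions, and the cone diffeomorphism of `ℝ³`
  set φ := B.sphereDiffeo χ χ' h1 h2 χ.contMDiff χ.symm.contMDiff hχ hχ'' K hKc hKb hχK hχK' with hφ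
  obtain ⟨Θ, hΘn, hΘc⟩ := exists_diffeomorph_norm_eq_eq_cone_two φ B.rad_pos
  have hΘn' : ∀ v, ‖Θ.symm v‖ = ‖v‖ := fun v => by
    conv_rhs => rw [← Θ.apply_symm_apply v]; rw [hΘn]
  have hΘc₁ : ∀ (t : ℝ) (u : Metric.sphere (0 : EuclideanSpace ℝ (Fin (2 + 1))) 1), B.rad / 2 ≤ t → t ≤ B.rad →
      Θ (t • (u : EuclideanSpace ℝ (Fin (2 + 1)))) =
        t • ((B.sphereMap χ hχ u : Metric.sphere (0 : EuclideanSpace ℝ (Fin (2 + 1))) 1) : EuclideanSpace ℝ (Fin (2 + 1))) :=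
    fun t u ht ht' => hΘc t u ht ht'
  have hΘc' : ∀ (t : ℝ) (u : Metric.sphere (0 : EuclideanSpace ℝ (Fin (2 + 1))) 1), B.rad / 2 ≤ t → t ≤ B.rad →
      Θ.symm (t • (u : EuclideanSpace ℝ (Fin (2 + 1)))) =
        t • ((B.sphereMap χ' hχ'' u : Metric.sphere (0 : EuclideanSpace ℝ (Fin (2 + 1))) 1) : EuclideanSpace ℝ (Fin (2 + 1))) := by
    intro t u ht ht'
    have h := hΘc t (B.sphereMap χ' hχ'' u) ht ht'
    have h3 : φ (B.sphereMap χ' hχ'' u) = u := BasinSetting.sphereMap_sphereMap h2 hχ'' hχ u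
    rw [h3] at h
    rw [← h, Θ.symm_apply_apply]
  set Ψ := B.extDiffeomorph χ χ' h1 h2 χ.contMDiff χ.symm.contMDiff hχ hχ'' K hKc hKb hχK hχK'
    Θ Θ.symm Θ.symm_apply_apply Θ.apply_symm_apply Θ.contMDiff Θ.symm.contMDiff hΘn hΘn' hΘc₁ hΘc' with hΨ
  refine ⟨Ψ, funext fun y => ?_⟩
  exact BasinSetting.ext_coe hKb hχK y

/-- **Extension of boundary diffeomorphisms which are the identity near the traces of the
co-cores** (dimension `3`; the endgame of the Morse line for the Torelli half of Griffiths'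
handlebody theorem).  Let `W` be a compact `3`-manifold with boundary, `g` a Morse function on
`(W; ∅, ∂W)` with a smooth gradient-like field `ξ` and a unique critical point `p₀` of index `0`
(e.g. the Morse data of a genus-`g` handlebody, `IsHandlebody`).  If a self-diffeomorphism `χ` of
`∂W` is the identity on an open set `U ⊆ ∂W` containing every boundary point NOT on a trajectory
coming from `p₀` (the traces of the ascending sets of the critical points of index `≥ 1`: for a
handlebody, the co-core circles), then `χ` extends to a self-diffeomorphism of `W`.  In
particular Dehn twists along simple closed curves of `∂W` missing the co-core circles, and all
diffeomorphisms supported away from them, extend.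
[cite: GriffithsHB1964Handlebody, main theorem and §§3–6] [cite: MilnorHCobordism1965, Thm. 3.4, Def. 3.9, Thm. 4.1] -/
theorem Cobordism.IsMorseFunction.diffeoExtends_of_eqOn_nhds_traces
    {g : W → ℝ} (hg : (Cobordism.ofBoundary 2 W).IsMorseFunction g)
    {ξ : Π x : W, TangentSpace (𝓡∂ (2 + 1)) x}
    (hξs : ContMDiff (𝓡∂ (2 + 1)) (𝓡∂ (2 + 1)).tangent ∞ fun x => (⟨x, ξ x⟩ : TangentBundle (𝓡∂ (2 + 1)) W))
    (hξ : IsGradientLike (𝓡∂ (2 + 1)) g ξ) {p₀ : W} (hp₀ : criticalSetOfIndex (𝓡∂ (2 + 1)) g 0 = {p₀})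
    (χ : (𝓡∂ (2 + 1)).boundary W ≃ₘ⟮𝓡 2, 𝓡 2⟯ (𝓡∂ (2 + 1)).boundary W)
    {U : Set ((𝓡∂ (2 + 1)).boundary W)} (hU : IsOpen U)
    (hUt : ∀ y : (𝓡∂ (2 + 1)).boundary W, (y : W) ∉ unstableSet (𝓡∂ (2 + 1)) ξ p₀ → y ∈ U)
    (hχU : ∀ y ∈ U, χ y = y) :
    (BoundaryManifold.boundaryData 2 W).DiffeoExtends χ := by
  obtain ⟨B⟩ := BasinSetting.nonempty hg hξs hξ hp₀
  have hpp : B.p₀ = p₀ := by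
    have h := B.p₀_mem_criticalSetOfIndex
    rw [hp₀] at h
    exact h
  refine B.diffeoExtends_of_forall_eq χ Uᶜ hU.isClosed_compl (fun y hy => ?_) (fun y hy => hχU y (not_not.1 hy))
  by_contra h
  exact hy (hUt y (by rw [BasinSetting.basin, hpp] at h; exact h))

end Three

end Literature.Topology.FourManifolds
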